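import Literature.Probability.RandomPlanarGeometry.HexSAWPathRigidity
import Literature.Probability.RandomPlanarGeometry.SAWEdgeListSurgery
import Summits.CriticalPhenomena.SAWScalingLimit.Theorems.SAWDevelopingMapSourceLoopBoundSourceLaw

/-!
# Winding classes of first arrivals at a walled vertex (the wall-door trick)

Helper file for the crux `NoFoldBound` (stmt-CriticalPhenomena-8296) of the route
`SAWDevelopingMap` (sub-problem `SAWScalingLimit` of `CriticalPhenomena`), line `Ideator3Sketch`,
stub `stub_walledClasses`.

Setting (Duminil-Copin–Smirnov 2012, §2): a finite vertex set `Λ` of the hexagonal lattice `ℍ`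
with connected complement (`hexDomainSimplyConnected`), a source mid-edge `a ∈ ∂Ω`
(`hexDomainBoundary`), and a WALLED vertex `v ∈ Λ`, `v ∉ a`, i.e. one with a neighbour `u ∉ Λ`;
the mid-edge `{v, u}` is then a boundary mid-edge of the domain (a "door" in the wall).  A FIRST
ARRIVAL at `v` is a walk `γ` from `a` to a mid-edge `{v, w}` (`w ≠ u` a neighbour of `v`) that
avoids `v`; it ends at `w`.  Appending the vertex `v` and leaving through the door gives a walk
`γ⁺ = γ.verts ++ [v]` from `a` to the boundary mid-edge `{v, u}`, whose winding is
`W(γ) + W(mid{w,v} → c(v) → mid{v,u})` (the last half-segment of `γ` is collinear with the edge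
`w v`).  By the rigidity of the winding between boundary mid-edges of a simply connected domain
(`HexMidEdgeSAW.winding_eq_of_mem_boundary`) all the `γ⁺` have the same winding, whence the
statement: `W(γ) + W(w → v → u) = W(γ') + W(w' → v → u)` for any two first arrivals `γ, γ'` at `v`
through `w, w'` (possibly `w = w'`).

## Contents (namespace `Summit.CriticalPhenomena.SAWScalingLimit.Theorems.SAWDevelopingMapNoFoldBound`)
* `arrival_verts_ne_nil`, `arrival_getLast?_eq` — a first arrival at `v` through `w` is
  nontrivial and ends at `w`;
* `door_mem_hexDomainBoundary` — the door `{v, u}` is a boundary mid-edge;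
* `winding_eq_of_verts_eq_concat` — the winding of a walk with vertex list `γ.verts ++ [v]`;
* `exists_doorExt` — the wall-door extension `γ⁺ : a → {v, u}` of a first arrival;
* **`stub_walledClasses`** — the statement above.
-/

noncomputable section

open scoped BigOperators
open Literature.Probability.LatticeModels Literature.Probability.RandomPlanarGeometry.SAW

namespace Summit.CriticalPhenomena.SAWScalingLimit.Theorems.SAWDevelopingMapNoFoldBound

variable {Λ : Finset HexVertex} {a : Sym2 HexVertex} {u v w : HexVertex}

/-! ### First arrivals at a vertex -/

/-- A walk from `a` to the mid-edge `{v, w}` with `v ∉ a` is nontrivial. -/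
theorem arrival_verts_ne_nil (hva : v ∉ a) (γ : HexMidEdgeSAW Λ a s(v, w)) : γ.verts ≠ [] :=
  fun h => hva (by rw [γ.eq_of_nil h]; exact Sym2.mem_mk_left v w)

/-- A first arrival at `v` through `w` (a walk from `a` to `{v, w}` avoiding `v`, `v ∉ a`) ends at
`w`. -/
theorem arrival_getLast?_eq (hva : v ∉ a) (γ : HexMidEdgeSAW Λ a s(v, w)) (hvγ : v ∉ γ.verts) :
    γ.verts.getLast? = some w := by
  have hne := arrival_verts_ne_nil hva γ
  rw [List.getLast?_eq_some_getLast hne, Option.some.injEq]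
  rcases γ.getLast_eq_or hne with h | h
  · have hm : γ.verts.getLast hne ∈ γ.verts := List.getLast_mem hne
    rw [h] at hm
    exact absurd hm hvγ
  · exact h

/-- The door `{v, u}` of a walled vertex (`v ∈ Λ`, `u ∉ Λ`, `v ∼ u`) is a boundary mid-edge of the
domain. -/
theorem door_mem_hexDomainBoundary (hu : u ∉ Λ) (hv : v ∈ Λ) (hvu : hexGraph.Adj v u) :
    s(v, u) ∈ hexDomainBoundary Λ :=
  ⟨(SimpleGraph.mem_edgeSet hexGraph).2 hvu, u, v, Sym2.eq_swap, hv, hu⟩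

/-! ### The wall-door extension -/

/-- **Additivity of the winding under the wall-door extension.** If `γ : a → {v, w}` has vertex
list `L₀ ++ [w]` and `γ₁ : a → {v, u}` has vertex list `L₀ ++ [w, v]`, then
`W(γ₁) = W(γ) + W(mid{w,v} → c(v) → mid{v,u})`: the last half-segment `c(w) → mid{v,w}` of `γ`
and the first half-segment `mid{w,v} → c(v)` of the one-step polyline are halves of the segment
`c(w) → c(v)` of `γ₁`. -/
theorem winding_eq_of_verts_eq_concat (γ : HexMidEdgeSAW Λ a s(v, w))
    (γ₁ : HexMidEdgeSAW Λ a s(v, u)) {L₀ : List HexVertex} (hγ : γ.verts = L₀ ++ [w])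
    (hγ₁ : γ₁.verts = L₀ ++ [w, v]) :
    γ₁.winding = γ.winding + winding [hexMidpoint s(w, v), hexCenter v, hexMidpoint s(v, u)] := by
  have hmid : hexMidpoint s(v, w) =
      hexCenter w + (1 / 2 : ℝ) * (hexCenter v - hexCenter w) := by
    rw [hexMidpoint_mk]; push_cast; ring
  have hmid' : hexMidpoint s(w, v) =
      hexCenter v + (1 / 2 : ℝ) * (hexCenter w - hexCenter v) := by
    rw [hexMidpoint_mk]; push_cast; ring
  have e1 : γ₁.points = (hexMidpoint a :: L₀.map hexCenter) ++
      [hexCenter w, hexCenter v, hexMidpoint s(v, u)] := by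
    simp [HexMidEdgeSAW.points, hγ₁]
  have e2 : γ.points = (hexMidpoint a :: L₀.map hexCenter) ++
      [hexCenter w, hexMidpoint s(v, w)] := by
    simp [HexMidEdgeSAW.points, hγ]
  rw [HexMidEdgeSAW.winding, HexMidEdgeSAW.winding, e1, e2, winding_concat₃, hmid,
    winding_concat_right_ray (t := 1 / 2) (by norm_num), winding_cons_cons_cons, winding_pair,
    add_zero, hmid', HV.turning_left_ray (t := 1 / 2) (by norm_num)]

/-- **The wall-door extension.** A first arrival `γ` at the walled vertex `v` through `w ≠ u`
(`v ∈ Λ`, `v ∉ a`, `u ∉ Λ`, `v ∼ u, w`, `v ∉ γ`) extends by the vertex `v` to a walk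
`γ⁺ = γ.verts ++ [v]` from `a` to the door `{v, u}` (self-avoiding since `v ∉ γ`; the new step
`{w, v}` and the new half-edge `{v, u}` are unused since `v ∉ γ`, `u ∉ Λ`, `v ∉ a`, `w ≠ u`), with
winding `W(γ⁺) = W(γ) + W(mid{w,v} → c(v) → mid{v,u})`. -/
theorem exists_doorExt (hu : u ∉ Λ) (hv : v ∈ Λ) (hva : v ∉ a) (hvu : hexGraph.Adj v u)
    (hvw : hexGraph.Adj v w) (hwu : w ≠ u) (γ : HexMidEdgeSAW Λ a s(v, w)) (hvγ : v ∉ γ.verts) :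
    ∃ γ₁ : HexMidEdgeSAW Λ a s(v, u), γ₁.verts = γ.verts ++ [v] ∧
      γ₁.winding = γ.winding + winding [hexMidpoint s(w, v), hexCenter v, hexMidpoint s(v, u)] := by
  have hne := arrival_verts_ne_nil hva γ
  have hlast := arrival_getLast?_eq hva γ hvγ
  obtain ⟨L₀, hL₀⟩ := List.getLast?_eq_some_iff.1 hlast
  refine ⟨⟨γ.verts ++ [v], ?_, ?_, ?_, ?_, ?_, ?_, fun _ => ?_, γ.fst_mem⟩, rfl, ?_⟩
  · -- the walk stays in the domain
    intro x hx
    rcases List.mem_append.1 hx with hx | hx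
    · exact γ.subset x hx
    · rw [List.mem_singleton.1 hx]; exact hv
  · -- self-avoiding
    exact List.nodup_append.2 ⟨γ.nodup, List.nodup_singleton v,
      fun x hx y hy hxy => hvγ (by rw [List.mem_singleton.1 hy] at hxy; exact hxy ▸ hx)⟩
  · -- consecutive vertices adjacent
    refine List.IsChain.append γ.isChain (List.isChain_singleton v) fun x hx y hy => ?_
    rw [Option.mem_def, hlast, Option.some.injEq] at hx
    rw [Option.mem_def, List.head?_cons, Option.some.injEq] at hy
    rw [← hx, ← hy]; exact hvw.symm
  · -- starts on `a`
    intro x hx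
    rw [List.head?_append_of_ne_nil _ hne] at hx
    exact γ.head_mem x hx
  · -- ends on the door `{v, u}`
    intro x hx
    rw [List.getLast?_concat, Option.some.injEq] at hx
    rw [← hx]; exact Sym2.mem_mk_left v u
  · -- nontrivial
    intro h; simp at h
  · -- no edge or half-edge is used twice
    rw [edges_concat hlast v, List.nodup_append]
    refine ⟨?_, List.nodup_singleton _, fun x hx y hy => ?_⟩
    · rw [Sym2.eq_swap (a := w) (b := v)]
      exact γ.edges_nodup hne
    · rw [List.mem_singleton] at hy
      subst hy
      rcases List.mem_cons.1 hx with rfl | hx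
      · -- `a ≠ {v, u}` since `v ∉ a`
        intro h; exact hva (by rw [h]; exact Sym2.mem_mk_left v u)
      rcases List.mem_append.1 hx with hx | hx
      · -- a step of `γ` does not contain `u ∉ Λ`
        rintro rfl
        exact hu (γ.subset u (forall_mem_of_mem_edges _ _ hx u (Sym2.mem_mk_right v u)))
      · -- `{w, v} ≠ {v, u}` since `u ≠ w, v`
        rw [List.mem_singleton.1 hx]
        intro h
        have hu' : u ∈ s(w, v) := by rw [h]; exact Sym2.mem_mk_right v u
        rcases Sym2.mem_iff.1 hu' with h' | h'
        · exact hwu h'.symm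
        · exact hvu.ne h'.symm
  · -- the winding
    refine winding_eq_of_verts_eq_concat γ _ hL₀ ?_
    change γ.verts ++ [v] = L₀ ++ [w, v]
    rw [hL₀, List.append_assoc]
    rfl

/-! ### The statement -/

/-- **Winding classes at a walled vertex (the wall-door trick).** In a simply connected `Λ` with
source `a ∈ ∂Ω`, for `v ∈ Λ` off `a` with a neighbour `u ∉ Λ`: any two first arrivals `γ, γ'` at
`v` (walks from `a` to `{v, w}`, `{v, w'}` avoiding `v`, `w, w' ≠ u` neighbours of `v`, possibly
`w = w'`) satisfy `W(γ) + W(w → v → u) = W(γ') + W(w' → v → u)`: both sides are the windings of the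
walks `γ + v`, `γ' + v` from `a` to the BOUNDARY mid-edge `{v, u}`, equal by
`HexMidEdgeSAW.winding_eq_of_mem_boundary`. -/
theorem stub_walledClasses :
    ∀ (Λ : Finset HexVertex), hexDomainSimplyConnected Λ → ∀ a ∈ hexDomainBoundary Λ,
      ∀ (u v : HexVertex), u ∉ Λ → v ∈ Λ → v ∉ a → hexGraph.Adj v u →
      ∀ (w w' : HexVertex), hexGraph.Adj v w → hexGraph.Adj v w' → w ≠ u → w' ≠ u →
      ∀ (γ : HexMidEdgeSAW Λ a s(v, w)) (γ' : HexMidEdgeSAW Λ a s(v, w')),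
        v ∉ γ.verts → v ∉ γ'.verts →
        γ.winding + winding [hexMidpoint s(w, v), hexCenter v, hexMidpoint s(v, u)] =
          γ'.winding + winding [hexMidpoint s(w', v), hexCenter v, hexMidpoint s(v, u)] := by
  intro Λ hΛ a ha u v hu hv hva hvu w w' hvw hvw' hwu hw'u γ γ' hvγ hvγ'
  obtain ⟨γ₁, -, h₁⟩ := exists_doorExt hu hv hva hvu hvw hwu γ hvγ
  obtain ⟨γ₁', -, h₁'⟩ := exists_doorExt hu hv hva hvu hvw' hw'u γ' hvγ'
  rw [← h₁, ← h₁']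
  exact HexMidEdgeSAW.winding_eq_of_mem_boundary hΛ ha (door_mem_hexDomainBoundary hu hv hvu) γ₁ γ₁'

end Summit.CriticalPhenomena.SAWScalingLimit.Theorems.SAWDevelopingMapNoFoldBound

end
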